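/-
Copyright (c) 2026. All rights reserved.
Released under Apache 2.0 license as described in the file LICENSE.
Authors: abc-iut cell, seat abc-iut-w5-d200 (gen 5).
-/
import Literature.GroupTheory.StronglyCompleteAbelianByAbelian
import Literature.GroupTheory.TopologicallyCyclicIndex
import Literature.NumberTheory.GaloisRepresentations.WildInertia
import Literature.NumberTheory.GaloisRepresentations.TameInertiaKummerProofs
import Literature.NumberTheory.GaloisRepresentations.LocalGaloisGroupFrobeniusProofs
import Literature.NumberTheory.GaloisRepresentations.CyclotomicCharacterSurjectiveProofs
import Literature.AnabelianGeometry.AbsoluteAnabelian.LocalUnramifiedQuotientH2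
import Literature.AnabelianGeometry.AbsoluteAnabelian.ProfiniteTerminology

/-!
# Finite-index subgroups of `Γ_F` containing the wild inertia group are open

Let `F` be a non-archimedean local field with residue characteristic `p`, `Γ_F = Gal(F̄/F)`,
`I_F = absInertia F` its inertia group and `P_F = absWildInertia F ϖ` its wild inertia group
(`ϖ` a uniformiser).  This proof-only file (0 definitions) shows that the *tame quotient*
`Γ_F ⧸ P_F` is **strongly complete**:

* `isOpen_of_finiteIndex_of_absWildInertia_le` — if `Γ_F` is topologically finitely generated (in the
  tree: unconditional for `F` of characteristic `0`, `Summits/ABC/IUTFork/MLFGaloisTFG.lean`), then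
  **every finite-index subgroup `K ≤ Γ_F` with `P_F ≤ K` is open**; quotient form
  `isOpen_of_finiteIndex_quotient_absWildInertia`.

This is hypothesis (a) of the wild-inertia reduction of the strong completeness of `Γ_F`
(abc-iut GAP row G-L3d2g2-1; the Nikolov–Segal fact F-1977 is consumed in the cell only at `Γ_F`).
The proof feeds the abstract dévissage
`Literature.GroupTheory.StronglyCompleteAbelianByAbelian.isOpen_of_finiteIndex_of_le_of_abelian_by_abelian_quotient`
(abelian-by-abelian profinite groups are strongly complete) with the structure of `Γ_F ⊇ I_F ⊇ P_F`
already in the tree: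

* `isClosed_absWildInertia` — `P_F` is closed (intersection of `I_F` with stabilisers);
* `commutator_mem_absInertia` — `Γ_F ⧸ I_F` is abelian (the Frobenius is topologically dense in
  `Γ_F ⧸ Gal(F̄/F^nr)`, `dense_zpowers_mk_of_isFrobPow`); `I_F ⧸ P_F` is abelian
  (`commutator_mem_absWildInertia`);
* `exists_pow_mem_of_absWildInertia_le` — **the image of `I_F` in any finite quotient `Γ_F ⧸ H` with
  `P_F ≤ H` has exponent prime to `p`**: the Frobenius acts on `I_F ⧸ P_F` by `u ↦ u ^ q`
  (`conj_mul_pow_inv_mem_absWildInertia`), so every element of `I_F` is a `q^a`-th power modulo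
  `P_F` for every `a`, which kills the `p`-part of the index;
* `exists_mem_absInertia_forall_mem_sup_zpowers` — hence, by the cyclicity of the tame quotients of
  `I_F` (`absInertia_exists_eq_mul_zpow`, Serre's `θ₀`), `I_F ≤ H ⊔ ⟨g_H⟩` for some `g_H ∈ I_F`, and by
  compactness (`exists_mem_absInertia_subset_closure`) one `g ∈ I_F` works for all `H`:
  **`I_F ⧸ P_F` is procyclic**, `I_F ⊆ closure (⟨g⟩ ⊔ P_F)`.

Nothing here asserts anything about [IUTchIII] Cor. 3.12; classical local theory (Serre, *Local
Fields*, Ch. IV §2; Iwasawa 1955) assembled over the tree's `absInertia` / `absWildInertia` API.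

[cite: SerreLocalFields1979, Ch. IV §2 Cor. 1 and Cor. 3 of Prop. 7]
[cite: SerreInventiones1972, §1.3 and §1.8 Prop. 6] [cite: RibesZalesskii2010, §4.2]
-/

noncomputable section

open Field ValuativeRel
open scoped Pointwise Valued

namespace Literature.AnabelianGeometry.AbsoluteAnabelian

namespace MLFGaloisTameStronglyComplete

open Literature.NumberTheory.GaloisRepresentations
open Literature.NumberTheory.GaloisRepresentations.IsNonarchimedeanLocalField
open Literature.GroupTheory
open _root_.Topology

universe u

variable {F : Type u} [Field F] [ValuativeRel F] [TopologicalSpace F] [IsNonarchimedeanLocalField F]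

/-! ### Closedness of `P_F`; `Γ_F ⧸ I_F` abelian -/

variable (F) in
/-- The wild inertia group `P_F = absWildInertia F ϖ` is closed in `Γ_F`: it is the intersection of the
closed inertia group (`isClosed_absInertia_holds`) with the closed sets `{σ | σ • z = z}`, `z` a
prime-to-`p`-th root of `ϖ`. [cite: SerreInventiones1972, §1.3] -/
theorem isClosed_absWildInertia (ϖ : 𝒪[F]) :
    IsClosed (absWildInertia F ϖ : Set (absoluteGaloisGroup F)) := by
  have hI : IsClosed (absInertia F : Set (absoluteGaloisGroup F)) := isClosed_absInertia_holds F
  have hset : (absWildInertia F ϖ : Set (absoluteGaloisGroup F)) =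
      (absInertia F : Set (absoluteGaloisGroup F)) ∩
        ⋂ (d : ℕ) (_ : 0 < d) (_ : ¬ ringChar 𝓀[F] ∣ d) (z : AlgebraicClosure F)
          (_ : z ^ d = algebraMap 𝒪[F] (AlgebraicClosure F) ϖ),
          {σ : absoluteGaloisGroup F | σ • z = z} := by
    ext σ
    simp only [SetLike.mem_coe, mem_absWildInertia_iff, Set.mem_inter_iff, Set.mem_iInter,
      Set.mem_setOf_eq]
  rw [hset]
  exact hI.inter (isClosed_iInter fun d => isClosed_iInter fun _ => isClosed_iInter fun _ =>
    isClosed_iInter fun z => isClosed_iInter fun _ => RootOfUnityAction.isClosed_setOf_smul_eq z z)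

/-- **`Γ_F ⧸ I_F` is abelian**: every commutator of `Γ_F` lies in the inertia group (the image of a
Frobenius lift generates a dense cyclic subgroup of the Hausdorff group `Γ_F ⧸ Gal(F̄/F^nr)`,
`dense_zpowers_mk_of_isFrobPow`, and `Gal(F̄/F^nr) = I_F`, `galUnr_eq_absInertia`).
[cite: SerreLocalFields1979, Ch. IV §2] -/
theorem commutator_mem_absInertia (x y : absoluteGaloisGroup F) :
    x * y * x⁻¹ * y⁻¹ ∈ absInertia F := by
  obtain ⟨φ, hφ⟩ := exists_isFrobPow_holds (F := F) 1
  have hd := dense_zpowers_mk_of_isFrobPow (F := F) hφ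
  have hcomm := mul_comm_of_dense_zpowers hd
    (QuotientGroup.mk x : absoluteGaloisGroup F ⧸ galUnr F) (QuotientGroup.mk y)
  rw [← galUnr_eq_absInertia, ← QuotientGroup.eq_one_iff]
  simp only [QuotientGroup.mk_mul, QuotientGroup.mk_inv]
  rw [hcomm, mul_inv_cancel_right, mul_inv_cancel]

/-! ### The exponent of `I_F` modulo a finite-index `H ⊇ P_F` is prime to `p` -/

/-- Frobenius descent: for a Frobenius lift `φ` and every `a`, every `τ ∈ I_F` is congruent modulo
`P_F` to a `q ^ a`-th power of an element of `I_F` (`φ σ φ⁻¹ ≡ σ ^ q (mod P_F)`,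
`conj_mul_pow_inv_mem_absWildInertia`, applied to `σ = φ⁻¹ τ φ` and iterated).
[cite: SerreInventiones1972, §1.8 Prop. 6] -/
theorem exists_pow_inv_mul_mem_absWildInertia {ϖ : 𝒪[F]} (hϖ0 : ϖ ≠ 0)
    {φ : absoluteGaloisGroup F} (hφ : IsFrobPow φ 1) (a : ℕ) {τ : absoluteGaloisGroup F}
    (hτ : τ ∈ absInertia F) :
    ∃ σ ∈ absInertia F, (σ ^ (residueFieldCard F ^ a))⁻¹ * τ ∈ absWildInertia F ϖ := by
  haveI : (absInertia F).Normal := absInertia_normal_holds F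
  haveI : (absWildInertia F ϖ).Normal := absWildInertia_normal F ϖ
  induction a generalizing τ with
  | zero => exact ⟨τ, hτ, by simp [(absWildInertia F ϖ).one_mem]⟩
  | succ a ih =>
    obtain ⟨σ, hσ, hστ⟩ := ih hτ
    -- `σ' = φ⁻¹ σ φ ∈ I_F` with `σ ≡ σ' ^ q (mod P_F)`
    set σ' : absoluteGaloisGroup F := φ⁻¹ * σ * φ⁻¹⁻¹ with hσ'
    have hσ'I : σ' ∈ absInertia F := Subgroup.Normal.conj_mem inferInstance σ hσ φ⁻¹
    have h1 := conj_mul_pow_inv_mem_absWildInertia (F := F) hϖ0 (m := 1)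
      (τ := φ) (by exact_mod_cast hφ) hσ'I
    have h2 : φ * σ' * φ⁻¹ = σ := by rw [hσ']; group
    rw [h2, pow_one] at h1
    refine ⟨σ', hσ'I, ?_⟩
    -- compute in `Γ_F ⧸ P_F`
    rw [← QuotientGroup.eq] at hστ ⊢
    have h3 : (QuotientGroup.mk σ : absoluteGaloisGroup F ⧸ absWildInertia F ϖ) =
        QuotientGroup.mk (σ' ^ residueFieldCard F) := by
      rw [QuotientGroup.eq_iff_div_mem, div_eq_mul_inv]
      exact h1
    rw [← hστ, QuotientGroup.mk_pow, QuotientGroup.mk_pow, h3, QuotientGroup.mk_pow, ← pow_mul,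
      ← pow_succ']

/-- **The image of `I_F` in a finite quotient `Γ_F ⧸ H` with `P_F ≤ H ⊴ Γ_F` has exponent prime to
`p`**: there is `d ≥ 1`, `p ∤ d`, with `τ ^ d ∈ H` for every `τ ∈ I_F` (namely the prime-to-`p` part
of the index of `H`: write `[Γ_F : H] = p^a d`; by Frobenius descent `τ ≡ σ^{q^a} (mod P_F)`, and
`σ^{q^a d}` is a power of `σ^{[Γ_F : H]} ∈ H` because `p ∣ q`).
[cite: SerreLocalFields1979, Ch. IV §2 Cor. 1 of Prop. 7] -/
theorem exists_pow_mem_of_absWildInertia_le {ϖ : 𝒪[F]} (hϖ0 : ϖ ≠ 0)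
    (H : Subgroup (absoluteGaloisGroup F)) [H.Normal] [H.FiniteIndex]
    (hPH : absWildInertia F ϖ ≤ H) :
    ∃ d : ℕ, 0 < d ∧ ¬ ringChar 𝓀[F] ∣ d ∧ ∀ τ ∈ absInertia F, τ ^ d ∈ H := by
  obtain ⟨φ, hφ⟩ := exists_isFrobPow_holds (F := F) 1
  set p := ringChar 𝓀[F] with hp
  have hpp : p.Prime := ringChar_residueField_prime (F := F)
  haveI : Fact p.Prime := ⟨hpp⟩
  set m := H.index with hm
  have hm0 : m ≠ 0 := Subgroup.FiniteIndex.index_ne_zero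
  set a := m.factorization p with ha
  refine ⟨ordCompl[p] m, Nat.ordCompl_pos p hm0, Nat.not_dvd_ordCompl hpp hm0, fun τ hτ => ?_⟩
  obtain ⟨σ, -, hστ⟩ := exists_pow_inv_mul_mem_absWildInertia hϖ0 hφ a hτ
  -- `p ∣ q`, so `q ^ a * d` is a multiple of `m = p ^ a * d`
  have hpq : p ∣ residueFieldCard F := (ringChar.spec 𝓀[F] _).mp cast_residueFieldCard_eq_zero
  obtain ⟨r, hr⟩ := hpq
  have hqa : residueFieldCard F ^ a * ordCompl[p] m = m * r ^ a := by
    rw [hr, mul_pow, mul_assoc, mul_comm (r ^ a), ← mul_assoc]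
    congr 1
    rw [ha]
    exact Nat.ordProj_mul_ordCompl_eq_self m p
  -- in `Γ_F ⧸ H`: `τ ≡ σ ^ (q ^ a)` and `σ ^ m ∈ H`
  have hστH : (σ ^ (residueFieldCard F ^ a))⁻¹ * τ ∈ H := hPH hστ
  have hσm : σ ^ (m * r ^ a) ∈ H := by
    rw [pow_mul]
    exact H.pow_mem (H.pow_index_mem σ) _
  rw [← QuotientGroup.eq] at hστH
  rw [← QuotientGroup.eq_one_iff, QuotientGroup.mk_pow, ← hστH, ← QuotientGroup.mk_pow, ← pow_mul,
    hqa, QuotientGroup.eq_one_iff]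
  exact hσm

/-! ### `I_F` is procyclic modulo `P_F` -/

/-- For an OPEN normal subgroup `H ⊇ P_F` of `Γ_F`, the image of `I_F` in `Γ_F ⧸ H` is cyclic: there
is `g ∈ I_F` with `I_F ≤ H ⊔ ⟨g⟩` (the exponent of the image is prime to `p` by
`exists_pow_mem_of_absWildInertia_le`, so the tree's `absInertia_exists_eq_mul_zpow` — tame quotients
of `I_F` are cyclic, via Serre's character `θ₀ : G_0 → (O_E/𝔓_E)ˣ` — applies).
[cite: SerreLocalFields1979, Ch. IV §2 Cor. 1 of Prop. 7] -/
theorem exists_mem_absInertia_forall_mem_sup_zpowers {ϖ : 𝒪[F]} (hϖ0 : ϖ ≠ 0)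
    (H : Subgroup (absoluteGaloisGroup F)) [H.Normal] (hHo : IsOpen (H : Set (absoluteGaloisGroup F)))
    (hPH : absWildInertia F ϖ ≤ H) :
    ∃ g ∈ absInertia F, ∀ σ ∈ absInertia F, σ ∈ H ⊔ Subgroup.zpowers g := by
  haveI : CompactSpace (absoluteGaloisGroup F) := absoluteGaloisGroup_compactSpace F
  haveI : Finite (absoluteGaloisGroup F ⧸ H) := Subgroup.quotient_finite_of_isOpen H hHo
  haveI : H.FiniteIndex := Subgroup.finiteIndex_of_finite_quotient
  obtain ⟨d, -, hpd, hd⟩ := exists_pow_mem_of_absWildInertia_le hϖ0 H hPH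
  -- a finite Galois `E/F` with `Gal(F̄/E) ≤ H`
  haveI : DiscreteTopology (absoluteGaloisGroup F ⧸ H) := QuotientGroup.discreteTopology hHo
  let π : absoluteGaloisGroup F →ₜ* absoluteGaloisGroup F ⧸ H :=
    ⟨QuotientGroup.mk' H, QuotientGroup.continuous_mk⟩
  obtain ⟨E, hfin, hgal, hker⟩ := exists_isGalois_ker_le F π
  haveI := hfin
  haveI := hgal
  have hkerH : (absRestrictNormalHom (K := F) E).ker ≤ H := by
    refine hker.trans ?_
    intro x hx
    rw [MonoidHom.mem_ker] at hx
    exact (QuotientGroup.eq_one_iff x).mp hx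
  -- the subgroup `N = H ∩ I_F` of `I_F`
  set N : Subgroup ↥(absInertia F) := H.subgroupOf (absInertia F) with hN
  have hNd : ∀ τ : ↥(absInertia F), τ ^ d ∈ N := fun τ => by
    rw [hN, Subgroup.mem_subgroupOf, Subgroup.coe_pow]
    exact hd τ τ.2
  have hNE : ∀ τ : ↥(absInertia F), absRestrictNormalHom E (τ : absoluteGaloisGroup F) = 1 → τ ∈ N :=
    fun τ hτ => by
      rw [hN, Subgroup.mem_subgroupOf]
      exact hkerH (by rwa [MonoidHom.mem_ker])
  obtain ⟨g, hg⟩ := absInertia_exists_eq_mul_zpow F hpd N hNd E hNE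
  refine ⟨g, g.2, fun σ hσ => ?_⟩
  obtain ⟨n, ν, hν, hσν⟩ := hg ⟨σ, hσ⟩
  have hνH : (ν : absoluteGaloisGroup F) ∈ H := by
    rw [hN, Subgroup.mem_subgroupOf] at hν
    exact hν
  have hσ' : σ = (ν : absoluteGaloisGroup F) * (g : absoluteGaloisGroup F) ^ n := by
    have := congrArg Subtype.val hσν
    simpa using this
  rw [hσ']
  exact Subgroup.mul_mem_sup hνH ((Subgroup.zpowers _).zpow_mem (Subgroup.mem_zpowers _) n)

omit [IsNonarchimedeanLocalField F] in
/-- A subset of a topological group which is saturated for right multiplication by an OPEN subgroup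
is closed (its complement is a union of cosets). [cite: RibesZalesskii2010, §2.1] -/
theorem isClosed_of_forall_mul_mem {G : Type*} [Group G] [TopologicalSpace G] [ContinuousMul G]
    {A : Set G} {H : Subgroup G} (hH : IsOpen (H : Set G))
    (hA : ∀ a ∈ A, ∀ h ∈ H, a * h ∈ A) : IsClosed A := by
  rw [← isOpen_compl_iff, isOpen_iff_forall_mem_open]
  intro x hx
  refine ⟨x • (H : Set G), fun y hy hyA => ?_, hH.smul x, ⟨1, H.one_mem, by simp⟩⟩
  obtain ⟨h, hh, rfl⟩ := hy
  have : x ∈ A := by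
    have h' := hA _ hyA h⁻¹ (H.inv_mem hh)
    simpa using h'
  exact hx this

/-- **`I_F ⧸ P_F` is procyclic**: there is `g ∈ I_F` such that `I_F` is contained in the closure of
the subgroup generated by `g` and `P_F` (compactness: the sets of `g ∈ I_F` generating `I_F` modulo
`P_F ⊔ V`, `V` open normal, are closed, nonempty by `exists_mem_absInertia_forall_mem_sup_zpowers`,
and directed). [cite: SerreInventiones1972, §1.3 Prop. 2] -/
theorem exists_mem_absInertia_subset_closure {ϖ : 𝒪[F]} (hϖ0 : ϖ ≠ 0) :
    ∃ g ∈ absInertia F, (absInertia F : Set (absoluteGaloisGroup F)) ⊆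
      closure ((Subgroup.zpowers g ⊔ absWildInertia F ϖ : Subgroup (absoluteGaloisGroup F)) :
        Set (absoluteGaloisGroup F)) := by
  classical
  haveI : CompactSpace (absoluteGaloisGroup F) := absoluteGaloisGroup_compactSpace F
  haveI : (absWildInertia F ϖ).Normal := absWildInertia_normal F ϖ
  -- the family of candidate generators modulo `P ⊔ V`, `V` open normal
  let HV : OpenNormalSubgroup (absoluteGaloisGroup F) → Subgroup (absoluteGaloisGroup F) := fun V =>
    absWildInertia F ϖ ⊔ (V : Subgroup (absoluteGaloisGroup F))
  let S : OpenNormalSubgroup (absoluteGaloisGroup F) → Set (absoluteGaloisGroup F) := fun V =>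
    (absInertia F : Set (absoluteGaloisGroup F)) ∩
      {g | ∀ σ ∈ absInertia F, σ ∈ HV V ⊔ Subgroup.zpowers g}
  have hHVo : ∀ V, IsOpen ((HV V : Subgroup (absoluteGaloisGroup F)) : Set (absoluteGaloisGroup F)) :=
    fun V => Subgroup.isOpen_mono le_sup_right V.isOpen'
  have hHVn : ∀ V, (HV V).Normal := fun V => Subgroup.sup_normal _ _
  -- monotone in `V`
  have hSmono : ∀ {V V' : OpenNormalSubgroup (absoluteGaloisGroup F)},
      ((V' : Subgroup (absoluteGaloisGroup F)) ≤ V) → S V' ⊆ S V := by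
    intro V V' hle g hg
    refine ⟨hg.1, fun σ hσ => ?_⟩
    exact (sup_le_sup_right (sup_le_sup_left hle (absWildInertia F ϖ)) _) (hg.2 σ hσ)
  -- each `S V` is closed
  have hSc : ∀ V, IsClosed (S V) := by
    intro V
    refine (isClosed_absInertia_holds F).inter ?_
    have hset : {g : absoluteGaloisGroup F | ∀ σ ∈ absInertia F, σ ∈ HV V ⊔ Subgroup.zpowers g} =
        ⋂ (σ : absoluteGaloisGroup F) (_ : σ ∈ absInertia F),
          {g : absoluteGaloisGroup F | σ ∈ HV V ⊔ Subgroup.zpowers g} := by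
      ext g; simp
    rw [hset]
    refine isClosed_iInter fun σ => isClosed_iInter fun _ => ?_
    refine isClosed_of_forall_mul_mem (hHVo V) fun g hg h hh => ?_
    -- `⟨g⟩ ≤ (P ⊔ V) ⊔ ⟨g h⟩` since `h ∈ P ⊔ V`
    have hle : HV V ⊔ Subgroup.zpowers g ≤ HV V ⊔ Subgroup.zpowers (g * h) := by
      refine sup_le le_sup_left ?_
      rw [Subgroup.zpowers_eq_closure, Subgroup.closure_le]
      intro x hx
      rw [Set.mem_singleton_iff.mp hx, SetLike.mem_coe]
      have hmem : (g * h) * h⁻¹ ∈ HV V ⊔ Subgroup.zpowers (g * h) :=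
        Subgroup.mul_mem _ (Subgroup.mem_sup_right (Subgroup.mem_zpowers _))
          (Subgroup.mem_sup_left ((HV V).inv_mem hh))
      rwa [mul_inv_cancel_right] at hmem
    exact hle hg
  -- each `S V` is nonempty
  have hSn : ∀ V, (S V).Nonempty := by
    intro V
    haveI := hHVn V
    obtain ⟨g, hgI, hg⟩ := exists_mem_absInertia_forall_mem_sup_zpowers hϖ0 (HV V) (hHVo V) le_sup_left
    exact ⟨g, hgI, hg⟩
  -- the family is directed
  have hSd : Directed (· ⊇ ·) S := by
    intro V₁ V₂
    refine ⟨V₁ ⊓ V₂, hSmono fun x hx => ?_, hSmono fun x hx => ?_⟩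
    · exact ((inf_le_left : V₁ ⊓ V₂ ≤ V₁) hx :)
    · exact ((inf_le_right : V₁ ⊓ V₂ ≤ V₂) hx :)
  -- the whole group as an open normal subgroup (for nonemptiness of the index type)
  let V₀ : OpenNormalSubgroup (absoluteGaloisGroup F) :=
    { toOpenSubgroup := ⟨⊤, isOpen_univ⟩, isNormal' := inferInstance }
  haveI : Nonempty (OpenNormalSubgroup (absoluteGaloisGroup F)) := ⟨V₀⟩
  obtain ⟨g, hg⟩ := IsCompact.nonempty_iInter_of_directed_nonempty_isCompact_isClosed S hSd hSn
    (fun V => (hSc V).isCompact) hSc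
  rw [Set.mem_iInter] at hg
  refine ⟨g, (hg V₀).1, fun σ hσ => ?_⟩
  -- `σ ∈ closure (⟨g⟩ ⊔ P)`: every neighbourhood `σ V` of `σ` meets it
  rw [mem_closure_iff]
  intro O hO hσO
  have h1 : (1 : absoluteGaloisGroup F) ∈ (fun v => σ * v) ⁻¹' O := by simpa using hσO
  obtain ⟨V, hV⟩ := ProfiniteGrp.exist_openNormalSubgroup_sub_open_nhds_of_one
    (hO.preimage (continuous_const.mul continuous_id)) h1
  have hσV := (hg V).2 σ hσ
  -- `(P ⊔ V) ⊔ ⟨g⟩ = (⟨g⟩ ⊔ P) ⊔ V`, and split `σ = a * v`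
  have heq : HV V ⊔ Subgroup.zpowers g =
      (Subgroup.zpowers g ⊔ absWildInertia F ϖ) ⊔ (V : Subgroup (absoluteGaloisGroup F)) := by
    show (absWildInertia F ϖ ⊔ (V : Subgroup (absoluteGaloisGroup F))) ⊔ Subgroup.zpowers g = _
    rw [sup_comm (Subgroup.zpowers g) (absWildInertia F ϖ), sup_right_comm]
  rw [heq] at hσV
  have hσV' : σ ∈ (((Subgroup.zpowers g ⊔ absWildInertia F ϖ : Subgroup (absoluteGaloisGroup F)) :
      Set (absoluteGaloisGroup F)) * ((V : Subgroup (absoluteGaloisGroup F)) :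
        Set (absoluteGaloisGroup F))) := by
    rw [← Subgroup.mul_normal]; exact hσV
  obtain ⟨a, ha, v, hv, hav⟩ := hσV'
  refine ⟨a, ?_, ha⟩
  have hav' : a = σ * v⁻¹ := by rw [← hav]; group
  rw [hav']
  exact hV ((V : Subgroup (absoluteGaloisGroup F)).inv_mem hv)

/-! ### The tame quotient of `Γ_F` is strongly complete -/

variable (F) in
/-- **Every finite-index subgroup of `Γ_F` containing the wild inertia group is open** — the tame
quotient `Γ_F ⧸ P_F` is strongly complete — for `Γ_F` topologically finitely generated (unconditional
for `F` of characteristic `0`: `Summits/ABC/IUTFork/MLFGaloisTFG.lean`) and `ϖ` a uniformiser.  The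
abstract dévissage `isOpen_of_finiteIndex_of_le_of_abelian_by_abelian_quotient` applied to
`P_F ≤ I_F ≤ Γ_F`: `P_F`, `I_F` closed normal, `I_F ⧸ P_F` abelian and procyclic, `Γ_F ⧸ I_F` abelian.
Hypothesis (a) of the wild-inertia reduction of «`Γ_F` strongly complete» (abc-iut G-L3d2g2-1).
[cite: SerreLocalFields1979, Ch. IV §2 Cor. 1 and Cor. 3 of Prop. 7] [cite: RibesZalesskii2010, §4.2] -/
theorem isOpen_of_finiteIndex_of_absWildInertia_le
    (hG : IsTopologicallyFinitelyGenerated (absoluteGaloisGroup F)) {ϖ : 𝒪[F]} (hϖ : Irreducible ϖ)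
    (K : Subgroup (absoluteGaloisGroup F)) [K.FiniteIndex] (hPK : absWildInertia F ϖ ≤ K) :
    IsOpen (K : Set (absoluteGaloisGroup F)) := by
  classical
  haveI : CompactSpace (absoluteGaloisGroup F) := absoluteGaloisGroup_compactSpace F
  haveI : (absWildInertia F ϖ).Normal := absWildInertia_normal F ϖ
  haveI : (absInertia F).Normal := absInertia_normal_holds F
  obtain ⟨g, hgI, hgcl⟩ := exists_mem_absInertia_subset_closure (F := F) hϖ.ne_zero
  obtain ⟨s, hs⟩ := hG.exists_finset
  have hS : ∃ S : Finset (absoluteGaloisGroup F),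
      Dense ((Subgroup.closure (S : Set (absoluteGaloisGroup F)) : Subgroup (absoluteGaloisGroup F)) :
        Set (absoluteGaloisGroup F)) := by
    refine ⟨s, ?_⟩
    rw [dense_iff_closure_eq, ← Subgroup.topologicalClosure_coe, hs, Subgroup.coe_top]
  refine StronglyCompleteAbelianByAbelian.isOpen_of_finiteIndex_of_le_of_abelian_by_abelian_quotient
    (absWildInertia F ϖ) (absInertia F) (isClosed_absWildInertia F ϖ) (isClosed_absInertia_holds F)
    (fun x hx y hy => commutator_mem_absWildInertia hϖ.ne_zero hx hy)
    (fun x y => commutator_mem_absInertia x y) (T := {g}) (by simpa using hgI) ?_ hS K hPK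
  rw [Finset.coe_singleton, ← Subgroup.zpowers_eq_closure]
  exact hgcl

variable (F) in
/-- Quotient form: **every finite-index subgroup of the tame quotient `Γ_F ⧸ P_F` is open** (quotient
topology), for `Γ_F` topologically finitely generated.
[cite: SerreLocalFields1979, Ch. IV §2 Cor. 1 and Cor. 3 of Prop. 7] [cite: RibesZalesskii2010, §4.2] -/
theorem isOpen_of_finiteIndex_quotient_absWildInertia
    (hG : IsTopologicallyFinitelyGenerated (absoluteGaloisGroup F)) {ϖ : 𝒪[F]} (hϖ : Irreducible ϖ)
    [(absWildInertia F ϖ).Normal]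
    (W : Subgroup (absoluteGaloisGroup F ⧸ absWildInertia F ϖ)) [W.FiniteIndex] :
    IsOpen (W : Set (absoluteGaloisGroup F ⧸ absWildInertia F ϖ)) :=
  (StronglyCompleteAbelianByAbelian.forall_isOpen_of_finiteIndex_of_le_iff_quotient
      (absWildInertia F ϖ)).mp
    (fun K hK hPK => by
      haveI := hK; exact isOpen_of_finiteIndex_of_absWildInertia_le F hG hϖ K hPK)
    W inferInstance

end MLFGaloisTameStronglyComplete

end Literature.AnabelianGeometry.AbsoluteAnabelian
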